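import Summits.QuantumFields.YangMills.Theorems.PoincareLipschitzTwoSidedOfConcentration
import Summits.QuantumFields.YangMills.Theorems.FibreConvexityTailHistoryTailOfTwoSided
import Summits.QuantumFields.YangMills.Theses.RevelationMartingale
import HarnessLib

/-!
# LINE 27 «MedianCentring» v1.1 — the first-moment crux is a 3/4-QUANTILE crux modulo K1 ∧ K2 (crux of record stmt-QuantumFields-19936
# `UnitScaleTilt.HistoryTailL`; registered target stmt-QuantumFields-23133 `RevelationMartingale.MeanDeviationShallowL`, N₁ := 3)

Ideator seat ym-r3-idea-2 g15 (planner-ym-r3-idea-2-g15-0), lens «nearmiss» (technique, not persona).  bears_on LADDER-YM rung R3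
(leaf `T3YM3TorusStatement.YM3TorusSU2`, YM₃ on Bałaban's T³) via crux 19936 through route PoincareLipschitz's cruxes K1
`MesoscopicConcentrationL` (stmt-23532) and K2 `BlockLipschitzL` (stmt-23533, LINE 25's organ road) and the LANDED glues
`PoincareLipschitz.TwoSidedOfConcentration.local_step` (p-accepted, ym-line-sfw-p2-w3 g30), `fibreConvexityTail_historyTailOfTwoSided_proof` (p609164).
HONESTY: no summit, no rung, no crux is proved by this line; the three stubs are open; NOT d = 4, NOT infinite volume, NOT a mass gap, NOT Clay.

THE NEAR MISS.  The K2 display of record (LEAD ★w1-19936 g10, K-8b) reads «`HistoryTailL` modulo {K1, S1″, S2♭″, `MeanDeviationL`}»: besides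
concentration (K1) and smoothness (K2 = the organ) the road still imports the FIRST-MOMENT crux `MeanDeviationL` (stmt-23083; E dist1(Ū^j(∂a)) ≤ θ/2
at every depth), used at exactly ONE place — the centring `E g ≤ ¾θ` of the capped McShane extension `g` in the one-height step
`local_step (hK1)(hK2)(hMean)(hGc)`.  Two measured deficits of every attempt on that crux: (D1) the tree's strongest theorem
`RevelationMartingaleMeanDeviationLogDepth.meanDeviation_logDepth` needs the depth hypothesis `b₀·L^(3j) ≤ p(g_(K−j))` because a MEAN bound by a
sup-certificate needs a K-UNIFORMLY TINY tail (`≤ g`) from a union bound over the `L^(3j)` finest plaquettes of the block; (D2) a mean sees the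
large-field region (events of probability `≪ 1` but deviation `O(1)`), i.e. needs Bałaban's R-operation.  THE SINGLE INPUT TO IMPROVE: centre at the
MEDIAN, not the mean.  If `Gibbs_K{f_a ≤ θ/8} ≥ 3/4` (a 3/4-QUANTILE bound) and `Gibbs_K(G(a,j)ᶜ) ≤ 1/4`, then `Gibbs_K{g ≤ θ/8} ≥ 1/2` (`g ≤ f_a` on
`G`), and K1 applied to `−g` (admissible: measurable, gauge invariant, box-local, Λ-Lipschitz) forces `E g ≤ θ/8 + nΛ·√(log(2Cc+2)/(cc·β_K))
= θ/8 + 17(CL+1)√(log(2Cc+2)/cc)·θ/p(g_(K−j)) ≤ θ/4` for `γ ≤ γ₁(L,b₀,p₀,Cc,cc,CL)` — the concentration inequality itself converts a median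
into a mean.  Hence the local window tail, `TwoSidedTailL ∧ TowerTailL` and `HistoryTailL` follow from {K1, K2, QUANTILE} with NO first-moment
input (display `HistoryTailL_of` below, kernel-checked), and the mean is RECOVERED afterwards (`E f_a ≤ E g + 2·tail + 2·Gibbs_K(Gᶜ)` with the budget
sharpened from `1/4` to `θ/16`) — so modulo K1 ∧ K2 the first-moment crux IS the quantile crux (the converse, quantile ⇐ mean at profile `b₀/16`, is
Markov's inequality).  WHY THE QUANTILE IS THE EASIER OBJECT: (i) events of probability `≤ 1/4` are invisible to it — no large-field machinery, only the
small-field (Gaussian-regime) analysis with probability `3/4`; (ii) union bounds only have to reach `1/4`, never a K-uniform `g_(K−j)·p`: the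
threshold is K-INDEPENDENT (no `log θ⁻¹` term; v1.1 CORRECTION: the cheap sup-certificate road reaches depth `L^(3j)·(j log L) ≲ p²` for the
quantile and `L^(3j)·(j log L + log g_(K−j)⁻¹) ≲ p²` for the mean — the SAME `(2/3)·log_L p` ceiling for both, so the gain of (ii) is the removed
`log g⁻¹`, NOT a doubled exponent; the landed `meanDeviation_logDepth` states the weaker range `b₀·L^(3j) ≤ p` for convenience); (iii) it is a statement about the LAW
of one bounded observable at constant precision — any distributional comparison of `f_a` with its lattice-Maxwell counterpart at Lévy–Prokhorov
distance `< 1/4` proves it (CLT currency), whereas a mean needs uniform integrability (large-deviation currency).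

SHAPE.  Three registered stubs and kernel-checked compositions:
* `stub_quantileDeviation` (Q) — the 3/4-quantile bound at `θ/8`, depths `1 ≤ j ≤ K − 2` (OPEN; in substance the small-field half of first-moment UV
  stability at depth; XL).  Consequence of `MeanDeviationL` by Markov (so never stronger than the crux it replaces).
* `stub_localTailOfMedian` (T) — K1 → K2 → (Q) → the LOCAL WINDOW TAIL at every depth (the conclusion of the landed `local_tail`, VERBATIM): the
  one-height step with the median in place of the mean + the landed strong induction (`compl_localGood_subset`, `card_near_le_real`,
  `localGood_budget`, `perPlaquette_boundedHeight_uniform`).  M.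
* `stub_meanOfMedian` (M) — K1 → K2 → (Q) → (T) → the mean bound `E f_a ≤ θ/2` at depths `j + 2 ≤ K`: `E f_a ≤ E g + 2·(local tail) + 2·Gibbs_K(Gᶜ)` with
  the budget sharpened to `θ(K−j)/16` (`exp(−c p(g_(K−i))²) ≤ g_(K−i)^A` for every power once `γ` is small).  M.
Compositions (no sorry): `MeanDeviationShallowL_of` = the registered target BY NAME with `N₁ := 3` (`3j ≤ K ∧ 1 ≤ j ⇒ j + 2 ≤ K`);
`TwoSided_of : K1 → K2 → TwoSidedTailL ∧ TowerTailL` (the landed assembly of `twoSidedOfConcentration_proof` with (T) for `local_tail`);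
`HistoryTailL_of : K1 → K2 → UnitScaleTilt.HistoryTailL` BY NAME through `fibreConvexityTail_historyTailOfTwoSided_proof` — the display
«`HistoryTailL` modulo {K1, K2, QUANTILE}».  Registered on 23133 (not on 19936, whose registry slot carries LINE 24 «SeveritySandwich» v5 — one
skeleton per item; ★★OWNER WORD 21 registry semantics).
-/

set_option autoImplicit false

namespace Summit.QuantumFields.YangMills.Cruxes.HistoryTailL.MedianCentring

open MeasureTheory
open scoped BigOperators
open Literature.MathematicalPhysics.QuantumFieldTheory.Balaban1983to89
open Literature.MathematicalPhysics.QuantumFieldTheory.Balaban1983to89.T3ContinuumYM3Torus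
open Literature.MathematicalPhysics.QuantumFieldTheory.Balaban1983to89.T3UnitScaleTilt
open Literature.MathematicalPhysics.QuantumFieldTheory.Balaban1983to89.T3UnitLawDensityEML (ℰp measurableE_ℰp)

/-- **(Q) `stub_quantileDeviation` — THE 3/4-QUANTILE BOUND (the new object; OPEN, XL in substance).**  For every `L` and profile `(b₀,p₀)` there is
`γ₁ ∈ (0,1]` such that for every family `F` with `F.L = L`, every `0 < γ ≤ γ₁`, all depths `1 ≤ j ≤ K − 2` and every level-`j` plaquette `a`:
`Gibbs_K{dist1(Ū^j(∂a)) ≤ θ(K−j)/8} ≥ 3/4`.  A CONSEQUENCE of the crux `MeanDeviationL` (Markov at profile `b₀/16`, `θ` is linear in `b₀`), hence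
never stronger than what it replaces; immune to every event of probability `≤ 1/4` (large fields, long towers).  WHY IT MIGHT FAIL: only together with
first-moment UV stability itself — beyond the certificate ceiling `L^(3j)·(j log L) ≲ p(g_(K−j))²` no tool outside Bałaban's small-field induction is known; the bet is that the
small-field half ALONE (Gaussian domination of the law of ONE block plaquette at precision 1/4) is reachable without the R-operation.  Cheapest
falsifier: a depth `j` at which the block plaquette's law has median `≫ g_(K−j)·p` — excluded in print ([Balaban1985UV3] (71)).
[cite: Balaban1985UV3, (7) p.257, (71) p.273; Balaban1985Averaging, Prop. 2] -/
theorem stub_quantileDeviation :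
    ∀ (L : ℕ) (b₀ p₀ : ℝ), 0 < b₀ → 2 < p₀ → ∃ γ₁ : ℝ, 0 < γ₁ ∧ γ₁ ≤ 1 ∧ ∀ (F : T3Family) (γ : ℝ), F.L = L → 0 < γ → γ ≤ γ₁ →
          ∀ (K j : ℕ), 1 ≤ j → j + 2 ≤ K → ∀ a : Plaq (F.P K) j,
            3 / 4 ≤ (gibbsK F ℰp γ K).real {U : GaugeField (F.P K) 0 (Matrix.specialUnitaryGroup (Fin 2) ℂ) | GaugeGroup.dist1 (GaugeField.plaqHol (Averaging.iter (fun i' => BlockAveraging.blockAvg (P := F.P K) (j := i') ℰp) j U) a) ≤ θBal F.L γ b₀ p₀ (K - j) / 8} := by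
  sorry

/-- **(T) `stub_localTailOfMedian` — THE LOCAL WINDOW TAIL FROM K1, K2 AND THE QUANTILE (M).**  Conclusion = the conclusion of the landed
`PoincareLipschitz.local_tail` VERBATIM (local good set `G(a,j)`, constants `(γ₁, C, c)` after `(L, b₀, p₀)`), hypotheses = the route cruxes
`MesoscopicConcentrationL` (K1) and `BlockLipschitzL` (K2) BY NAME and (Q).  Proof plan: the one-height step with the MEDIAN — capped McShane extension
`g` of `f_a|_G` (`exists_capped_infConvolution`, box link pseudometric, `Λ = (CL+1)/√(L^j)`, `n = 17L^j`), `Gibbs_K{g ≤ θ/8} ≥ 3/4 − Gibbs_K(Gᶜ) ≥ 1/2`,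
K1 for `−g` at `r₀ = θ/8` gives `E g ≤ θ/4` once `17(CL+1)·√(log(2Cc+2)/cc) ≤ p(g_(K−j))/8` (small `γ`), then K1 for `g` at `r = 3θ/4`; the strong
induction on `j` with `Gibbs_K(G(a,j)ᶜ) ≤ 1/4` is the landed one (`compl_localGood_subset`, `card_near_le_real`, `localGood_budget`,
`perPlaquette_boundedHeight_uniform L 0`).  WHY IT MIGHT FAIL: it does not — every ingredient is landed; only the exponent constant changes
(`cc·(3/4)²·p²/(289(CL+1)²)`).  [cite: Balaban1985UV3, (3) p.256 and (7) p.257; Ledoux2001, Prop. 1.3 (concentration around median vs mean)] -/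
theorem stub_localTailOfMedian :
    Summit.QuantumFields.YangMills.Theses.PoincareLipschitz.MesoscopicConcentrationL →
    Summit.QuantumFields.YangMills.Theses.PoincareLipschitz.BlockLipschitzL →
    (∀ (L : ℕ) (b₀ p₀ : ℝ), 0 < b₀ → 2 < p₀ → ∃ γ₁ : ℝ, 0 < γ₁ ∧ γ₁ ≤ 1 ∧ ∀ (F : T3Family) (γ : ℝ), F.L = L → 0 < γ → γ ≤ γ₁ →
            ∀ (K j : ℕ), 1 ≤ j → j + 2 ≤ K → ∀ a : Plaq (F.P K) j,
              3 / 4 ≤ (gibbsK F ℰp γ K).real {U : GaugeField (F.P K) 0 (Matrix.specialUnitaryGroup (Fin 2) ℂ) | GaugeGroup.dist1 (GaugeField.plaqHol (Averaging.iter (fun i' => BlockAveraging.blockAvg (P := F.P K) (j := i') ℰp) j U) a) ≤ θBal F.L γ b₀ p₀ (K - j) / 8}) →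
    ∀ (L : ℕ) (b₀ p₀ : ℝ), 0 < b₀ → 2 < p₀ → ∃ (γ₁ C c : ℝ), 0 < γ₁ ∧ γ₁ ≤ 1 ∧ 0 ≤ C ∧ 0 < c ∧ ∀ (F : T3Family) (γ : ℝ), F.L = L → 0 < γ → γ ≤ γ₁ →
          ∀ (K j : ℕ), 1 ≤ j → j + 2 ≤ K → ∀ a : Plaq (F.P K) j,
            (gibbsK F ℰp γ K).real ({U : GaugeField (F.P K) 0 (Matrix.specialUnitaryGroup (Fin 2) ℂ) | θBal F.L γ b₀ p₀ (K - j) ≤ GaugeGroup.dist1 (GaugeField.plaqHol (Averaging.iter (fun i' => BlockAveraging.blockAvg (P := F.P K) (j := i') ℰp) j U) a)} ∩ {U : GaugeField (F.P K) 0 (Matrix.specialUnitaryGroup (Fin 2) ℂ) | (∀ (i : ℕ) (q : Plaq (F.P K) i), i < j → Site.tdist (fun k => ((((q.src k).val * F.L ^ i : ℕ)) : ZMod ((F.P K).sitesPerDir 0))) (fun k => ((((a.src k).val * F.L ^ j : ℕ)) : ZMod ((F.P K).sitesPerDir 0))) + 64 * F.L ^ i ≤ 64 * F.L ^ j → GaugeGroup.dist1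 (GaugeField.plaqHol (Averaging.iter (fun i' => BlockAveraging.blockAvg (P := F.P K) (j := i') ℰp) i U) q) < θBal F.L γ b₀ p₀ (K - i))}) ≤
              C * Real.exp (-(c * B10.pFun b₀ p₀ (Real.sqrt (γ * ((F.L : ℝ)⁻¹) ^ (K - j))) ^ 2)) := by
  sorry

/-- **(M) `stub_meanOfMedian` — THE MEAN RECOVERED (M).**  From K1, K2, (Q) and the local window tail (T): `E dist1(Ū^j(∂a)) ≤ θ(K−j)/2` at all depths
`1 ≤ j ≤ K − 2`.  Proof plan: with `g` as in (T), `f_a = g` on `G ∩ {f_a < θ}` and `f_a ≤ 2` (`dist1_le_two_specialUnitaryGroup`), so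
`E f_a ≤ E g + 2·Gibbs_K({θ ≤ f_a} ∩ G) + 2·Gibbs_K(Gᶜ) ≤ θ/4 + 2C·exp(−c p²) + 2·Gibbs_K(Gᶜ)`, and the local-good budget is re-run at precision
`θ(K−j)/16` instead of `1/4` (`9·129³·Σ_i L^(3(j−i))·C·exp(−c p(g_(K−i))²) ≤ θ(K−j)/16` for `γ ≤ γ_B`: `exp(−c p(g)²) ≤ g^8` for small `g`,
`Σ_i L^(3(j−i)) g_(K−i)^8 ≤ 2 g_(K−j)^2`).  WHY IT MIGHT FAIL: it does not (arithmetic on landed rows); typed as a stub because the sharpened budget is a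
new scalar lemma.  [cite: Balaban1985UV3, (71) p.273] -/
theorem stub_meanOfMedian :
    Summit.QuantumFields.YangMills.Theses.PoincareLipschitz.MesoscopicConcentrationL →
    Summit.QuantumFields.YangMills.Theses.PoincareLipschitz.BlockLipschitzL →
    (∀ (L : ℕ) (b₀ p₀ : ℝ), 0 < b₀ → 2 < p₀ → ∃ γ₁ : ℝ, 0 < γ₁ ∧ γ₁ ≤ 1 ∧ ∀ (F : T3Family) (γ : ℝ), F.L = L → 0 < γ → γ ≤ γ₁ →
            ∀ (K j : ℕ), 1 ≤ j → j + 2 ≤ K → ∀ a : Plaq (F.P K) j,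
              3 / 4 ≤ (gibbsK F ℰp γ K).real {U : GaugeField (F.P K) 0 (Matrix.specialUnitaryGroup (Fin 2) ℂ) | GaugeGroup.dist1 (GaugeField.plaqHol (Averaging.iter (fun i' => BlockAveraging.blockAvg (P := F.P K) (j := i') ℰp) j U) a) ≤ θBal F.L γ b₀ p₀ (K - j) / 8}) →
    (∀ (L : ℕ) (b₀ p₀ : ℝ), 0 < b₀ → 2 < p₀ → ∃ (γ₁ C c : ℝ), 0 < γ₁ ∧ γ₁ ≤ 1 ∧ 0 ≤ C ∧ 0 < c ∧ ∀ (F : T3Family) (γ : ℝ), F.L = L → 0 < γ → γ ≤ γ₁ →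
            ∀ (K j : ℕ), 1 ≤ j → j + 2 ≤ K → ∀ a : Plaq (F.P K) j,
              (gibbsK F ℰp γ K).real ({U : GaugeField (F.P K) 0 (Matrix.specialUnitaryGroup (Fin 2) ℂ) | θBal F.L γ b₀ p₀ (K - j) ≤ GaugeGroup.dist1 (GaugeField.plaqHol (Averaging.iter (fun i' => BlockAveraging.blockAvg (P := F.P K) (j := i') ℰp) j U) a)} ∩ {U : GaugeField (F.P K) 0 (Matrix.specialUnitaryGroup (Fin 2) ℂ) | (∀ (i : ℕ) (q : Plaq (F.P K) i), i < j → Site.tdist (fun k => ((((q.src k).val * F.L ^ i : ℕ)) : ZMod ((F.P K).sitesPerDir 0))) (fun k => ((((a.src k).val * F.L ^ j : ℕ)) : ZMod ((F.P K).sitesPerDir 0))) + 64 * F.L ^ i ≤ 64 * F.L ^ j → GaugeGroup.dist1 (GaugeField.plaqHol (Averaging.iter (fun i' => BlockAveraging.blockAvg (P := F.P K) (j := i') ℰp) i U) q) < θBal F.L γ b₀ p₀ (K - i))}) ≤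
                C * Real.exp (-(c * B10.pFun b₀ p₀ (Real.sqrt (γ * ((F.L : ℝ)⁻¹) ^ (K - j))) ^ 2))) →
    ∀ (L : ℕ) (b₀ p₀ : ℝ), 0 < b₀ → 2 < p₀ → ∃ γ₁ : ℝ, 0 < γ₁ ∧ γ₁ ≤ 1 ∧ ∀ (F : T3Family) (γ : ℝ), F.L = L → 0 < γ → γ ≤ γ₁ →
          ∀ (K j : ℕ), 1 ≤ j → j + 2 ≤ K → ∀ a : Plaq (F.P K) j,
            ∫ U, GaugeGroup.dist1 (GaugeField.plaqHol (Averaging.iter (fun i' => BlockAveraging.blockAvg (P := F.P K) (j := i') ℰp) j U) a) ∂(gibbsK F ℰp γ K) ≤ θBal F.L γ b₀ p₀ (K - j) / 2 := by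
  sorry

/-- ★ THE REGISTERED TARGET BY NAME: `RevelationMartingale.MeanDeviationShallowL` (stmt-QuantumFields-23133) with depth fraction `N₁ := 3`
(`1 ≤ j ∧ 3j ≤ K ⇒ j + 2 ≤ K`), from K1, K2 and the three stubs.  No sorry outside the stubs. -/
theorem MeanDeviationShallowL_of
    (hC : Summit.QuantumFields.YangMills.Theses.PoincareLipschitz.MesoscopicConcentrationL)
    (hLip : Summit.QuantumFields.YangMills.Theses.PoincareLipschitz.BlockLipschitzL) :
    Summit.QuantumFields.YangMills.Theses.RevelationMartingale.MeanDeviationShallowL := by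
  intro L
  refine ⟨3, by norm_num, fun b₀ p₀ hb₀ hp₀ => ?_⟩
  obtain ⟨γ₁, hγ₁, hγ₁1, H⟩ := stub_meanOfMedian hC hLip stub_quantileDeviation
    (stub_localTailOfMedian hC hLip stub_quantileDeviation) L b₀ p₀ hb₀ hp₀
  exact ⟨γ₁, hγ₁, hγ₁1, fun F γ hFL hγ hγle K j hj hjK a => H F γ hFL hγ hγle K j hj (by omega) a⟩

/-- ★ DISPLAY 1: `FibreConvexityTail.TwoSidedTailL ∧ FibreConvexityTail.TowerTailL` from K1, K2 and the stubs (Q), (T) — the landed assembly of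
`twoSidedOfConcentration_proof` with (T) in place of `local_tail`; NO first-moment hypothesis. -/
theorem TwoSided_of
    (hT : Summit.QuantumFields.YangMills.Theses.PoincareLipschitz.MesoscopicConcentrationL →
      Summit.QuantumFields.YangMills.Theses.PoincareLipschitz.BlockLipschitzL →
      (∀ (L : ℕ) (b₀ p₀ : ℝ), 0 < b₀ → 2 < p₀ → ∃ γ₁ : ℝ, 0 < γ₁ ∧ γ₁ ≤ 1 ∧ ∀ (F : T3Family) (γ : ℝ), F.L = L → 0 < γ → γ ≤ γ₁ →
              ∀ (K j : ℕ), 1 ≤ j → j + 2 ≤ K → ∀ a : Plaq (F.P K) j,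
                3 / 4 ≤ (gibbsK F ℰp γ K).real {U : GaugeField (F.P K) 0 (Matrix.specialUnitaryGroup (Fin 2) ℂ) | GaugeGroup.dist1 (GaugeField.plaqHol (Averaging.iter (fun i' => BlockAveraging.blockAvg (P := F.P K) (j := i') ℰp) j U) a) ≤ θBal F.L γ b₀ p₀ (K - j) / 8}) →
      ∀ (L : ℕ) (b₀ p₀ : ℝ), 0 < b₀ → 2 < p₀ → ∃ (γ₁ C c : ℝ), 0 < γ₁ ∧ γ₁ ≤ 1 ∧ 0 ≤ C ∧ 0 < c ∧ ∀ (F : T3Family) (γ : ℝ), F.L = L → 0 < γ → γ ≤ γ₁ →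
            ∀ (K j : ℕ), 1 ≤ j → j + 2 ≤ K → ∀ a : Plaq (F.P K) j,
              (gibbsK F ℰp γ K).real ({U : GaugeField (F.P K) 0 (Matrix.specialUnitaryGroup (Fin 2) ℂ) | θBal F.L γ b₀ p₀ (K - j) ≤ GaugeGroup.dist1 (GaugeField.plaqHol (Averaging.iter (fun i' => BlockAveraging.blockAvg (P := F.P K) (j := i') ℰp) j U) a)} ∩ {U : GaugeField (F.P K) 0 (Matrix.specialUnitaryGroup (Fin 2) ℂ) | (∀ (i : ℕ) (q : Plaq (F.P K) i), i < j → Site.tdist (fun k => ((((q.src k).val * F.L ^ i : ℕ)) : ZMod ((F.P K).sitesPerDir 0))) (fun k => ((((a.src k).val * F.L ^ j : ℕ)) : ZMod ((F.P K).sitesPerDir 0))) + 64 * F.L ^ i ≤ 64 * F.L ^ j → GaugeGroup.dist1 (GaugeField.plaqHol (Averaging.iter (fun i' => BlockAveraging.blockAvg (P := F.P K) (j := i') ℰp) i U) q) < θBal F.L γ b₀ p₀ (K - i))}) ≤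
                C * Real.exp (-(c * B10.pFun b₀ p₀ (Real.sqrt (γ * ((F.L : ℝ)⁻¹) ^ (K - j))) ^ 2)))
    (hQ : ∀ (L : ℕ) (b₀ p₀ : ℝ), 0 < b₀ → 2 < p₀ → ∃ γ₁ : ℝ, 0 < γ₁ ∧ γ₁ ≤ 1 ∧ ∀ (F : T3Family) (γ : ℝ), F.L = L → 0 < γ → γ ≤ γ₁ →
            ∀ (K j : ℕ), 1 ≤ j → j + 2 ≤ K → ∀ a : Plaq (F.P K) j,
              3 / 4 ≤ (gibbsK F ℰp γ K).real {U : GaugeField (F.P K) 0 (Matrix.specialUnitaryGroup (Fin 2) ℂ) | GaugeGroup.dist1 (GaugeField.plaqHol (Averaging.iter (fun i' => BlockAveraging.blockAvg (P := F.P K) (j := i') ℰp) j U) a) ≤ θBal F.L γ b₀ p₀ (K - j) / 8})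
    (hC : Summit.QuantumFields.YangMills.Theses.PoincareLipschitz.MesoscopicConcentrationL)
    (hLip : Summit.QuantumFields.YangMills.Theses.PoincareLipschitz.BlockLipschitzL) :
    Summit.QuantumFields.YangMills.Theses.FibreConvexityTail.TwoSidedTailL ∧ Summit.QuantumFields.YangMills.Theses.FibreConvexityTail.TowerTailL := by
  refine ⟨fun L => ⟨0, fun b₀ p₀ _ hb₀ hp₀ => ?_⟩, fun L => ⟨0, fun b₀ p₀ _ hb₀ hp₀ => ?_⟩⟩
  · obtain ⟨γ₁, C, c, hγ₁, hγ₁1, hC0, hc, H⟩ := hT hC hLip hQ L b₀ p₀ hb₀ hp₀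
    refine ⟨γ₁, hγ₁, hγ₁1, fun F γ hFL hγ hle => ⟨C, 0, c, hC0, hc, fun K j hj hjK a => ?_⟩⟩
    haveI := isProbabilityMeasure_gibbsK F ℰp hγ.le K
    have hsub : ({U : GaugeField (F.P K) 0 (Matrix.specialUnitaryGroup (Fin 2) ℂ) | θBal F.L γ b₀ p₀ (K - j) ≤ GaugeGroup.dist1 (GaugeField.plaqHol (Averaging.iter (fun i' => BlockAveraging.blockAvg (P := F.P K) (j := i') ℰp) j U) a)} ∩
          {U : GaugeField (F.P K) 0 (Matrix.specialUnitaryGroup (Fin 2) ℂ) | ∀ i, i < j → PlaqSmall (θBal F.L γ b₀ p₀ (K - i)) (Averaging.iter (fun i' => BlockAveraging.blockAvg (P := F.P K) (j := i') ℰp) i U)} ∩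
          {U : GaugeField (F.P K) 0 (Matrix.specialUnitaryGroup (Fin 2) ℂ) | PlaqSmall (θBal F.L γ b₀ p₀ (K - (j + 2))) (Averaging.iter (fun i' => BlockAveraging.blockAvg (P := F.P K) (j := i') ℰp) (j + 2) U)}) ⊆
        ({U : GaugeField (F.P K) 0 (Matrix.specialUnitaryGroup (Fin 2) ℂ) | θBal F.L γ b₀ p₀ (K - j) ≤ GaugeGroup.dist1 (GaugeField.plaqHol (Averaging.iter (fun i' => BlockAveraging.blockAvg (P := F.P K) (j := i') ℰp) j U) a)} ∩ {U : GaugeField (F.P K) 0 (Matrix.specialUnitaryGroup (Fin 2) ℂ) | (∀ (i : ℕ) (q : Plaq (F.P K) i), i < j → Site.tdist (fun k => ((((q.src k).val * F.L ^ i : ℕ)) : ZMod ((F.P K).sitesPerDir 0))) (fun k => ((((a.src k).val * F.L ^ j : ℕ)) : ZMod ((F.P K).sitesPerDir 0))) + 64 * F.L ^ i ≤ 64 * F.L ^ j → GaugeGroup.dist1 (GaugeField.plaqHol (Averaging.iter (fun i' => BlockAveraging.blockAvg (P := F.P K) (j := i') ℰp) i U) q) < θBal F.L γ b₀ p₀ (K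 - i))}) := by
      rintro U ⟨⟨hU1, hU2⟩, -⟩
      exact ⟨hU1, fun i q hi _ => hU2 i hi q⟩
    calc (gibbsK F ℰp γ K).real ({U : GaugeField (F.P K) 0 (Matrix.specialUnitaryGroup (Fin 2) ℂ) | θBal F.L γ b₀ p₀ (K - j) ≤ GaugeGroup.dist1 (GaugeField.plaqHol (Averaging.iter (fun i' => BlockAveraging.blockAvg (P := F.P K) (j := i') ℰp) j U) a)} ∩
          {U : GaugeField (F.P K) 0 (Matrix.specialUnitaryGroup (Fin 2) ℂ) | ∀ i, i < j → PlaqSmall (θBal F.L γ b₀ p₀ (K - i)) (Averaging.iter (fun i' => BlockAveraging.blockAvg (P := F.P K) (j := i') ℰp) i U)} ∩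
          {U : GaugeField (F.P K) 0 (Matrix.specialUnitaryGroup (Fin 2) ℂ) | PlaqSmall (θBal F.L γ b₀ p₀ (K - (j + 2))) (Averaging.iter (fun i' => BlockAveraging.blockAvg (P := F.P K) (j := i') ℰp) (j + 2) U)})
        ≤ (gibbsK F ℰp γ K).real ({U : GaugeField (F.P K) 0 (Matrix.specialUnitaryGroup (Fin 2) ℂ) | θBal F.L γ b₀ p₀ (K - j) ≤ GaugeGroup.dist1 (GaugeField.plaqHol (Averaging.iter (fun i' => BlockAveraging.blockAvg (P := F.P K) (j := i') ℰp) j U) a)} ∩ {U : GaugeField (F.P K) 0 (Matrix.specialUnitaryGroup (Fin 2) ℂ) | (∀ (i : ℕ) (q : Plaq (F.P K) i), i < j → Site.tdist (fun k => ((((q.src k).val * F.L ^ i : ℕ)) : ZMod ((F.P K).sitesPerDir 0))) (fun k => ((((a.src k).val * F.L ^ j : ℕ)) : ZMod ((F.P K).sitesPerDir 0))) + 64 * F.L ^ i ≤ 64 * F.L ^ j → GaugeGroup.dist1 (GaugeField.plaqHol (Averaging.iter (fun i' => BlockAveraging.blockAvg (P := F.P K) (j := i') ℰp) i U) q) < θBal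 F.L γ b₀ p₀ (K - i))}) :=
          measureReal_mono hsub (measure_ne_top _ _)
      _ ≤ C * Real.exp (-(c * B10.pFun b₀ p₀ (Real.sqrt (γ * ((F.L : ℝ)⁻¹) ^ (K - j))) ^ 2)) := H F γ hFL hγ hle K j hj hjK a
      _ = C * (F.scheme ℰp γ).β (K - j) ^ 0 * Real.exp (-(c * B10.pFun b₀ p₀ (Real.sqrt (γ * ((F.L : ℝ)⁻¹) ^ (K - j))) ^ 2)) := by
          rw [pow_zero, mul_one]
  · obtain ⟨γ₁, C, c, hγ₁, hγ₁1, hC0, hc, H⟩ := hT hC hLip hQ L b₀ p₀ hb₀ hp₀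
    refine ⟨γ₁, hγ₁, hγ₁1, fun F γ hFL hγ hle => ⟨C, 0, c, hC0, hc, fun K j hj hjK a => ?_⟩⟩
    haveI := isProbabilityMeasure_gibbsK F ℰp hγ.le K
    have hsub : ({U : GaugeField (F.P K) 0 (Matrix.specialUnitaryGroup (Fin 2) ℂ) | θBal F.L γ b₀ p₀ (K - j) ≤ GaugeGroup.dist1 (GaugeField.plaqHol (Averaging.iter (fun i' => BlockAveraging.blockAvg (P := F.P K) (j := i') ℰp) j U) a)} ∩
          {U : GaugeField (F.P K) 0 (Matrix.specialUnitaryGroup (Fin 2) ℂ) | ∀ i, i < j → PlaqSmall (θBal F.L γ b₀ p₀ (K - i)) (Averaging.iter (fun i' => BlockAveraging.blockAvg (P := F.P K) (j := i') ℰp) i U)} ∩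
          {U : GaugeField (F.P K) 0 (Matrix.specialUnitaryGroup (Fin 2) ℂ) | ¬ PlaqSmall (θBal F.L γ b₀ p₀ (K - (j + 2))) (Averaging.iter (fun i' => BlockAveraging.blockAvg (P := F.P K) (j := i') ℰp) (j + 2) U)}) ⊆
        ({U : GaugeField (F.P K) 0 (Matrix.specialUnitaryGroup (Fin 2) ℂ) | θBal F.L γ b₀ p₀ (K - j) ≤ GaugeGroup.dist1 (GaugeField.plaqHol (Averaging.iter (fun i' => BlockAveraging.blockAvg (P := F.P K) (j := i') ℰp) j U) a)} ∩ {U : GaugeField (F.P K) 0 (Matrix.specialUnitaryGroup (Fin 2) ℂ) | (∀ (i : ℕ) (q : Plaq (F.P K) i), i < j → Site.tdist (fun k => ((((q.src k).val * F.L ^ i : ℕ)) : ZMod ((F.P K).sitesPerDir 0))) (fun k => ((((a.src k).val * F.L ^ j : ℕ)) : ZMod ((F.P K).sitesPerDir 0))) + 64 * F.L ^ i ≤ 64 * F.L ^ j → GaugeGroup.dist1 (GaugeField.plaqHol (Averaging.iter (fun i' => BlockAveraging.blockAvg (P := F.P K) (j := i') ℰp) i U) q) < θBal F.L γ b₀ p₀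 (K - i))}) := by
      rintro U ⟨⟨hU1, hU2⟩, -⟩
      exact ⟨hU1, fun i q hi _ => hU2 i hi q⟩
    calc (gibbsK F ℰp γ K).real ({U : GaugeField (F.P K) 0 (Matrix.specialUnitaryGroup (Fin 2) ℂ) | θBal F.L γ b₀ p₀ (K - j) ≤ GaugeGroup.dist1 (GaugeField.plaqHol (Averaging.iter (fun i' => BlockAveraging.blockAvg (P := F.P K) (j := i') ℰp) j U) a)} ∩
          {U : GaugeField (F.P K) 0 (Matrix.specialUnitaryGroup (Fin 2) ℂ) | ∀ i, i < j → PlaqSmall (θBal F.L γ b₀ p₀ (K - i)) (Averaging.iter (fun i' => BlockAveraging.blockAvg (P := F.P K) (j := i') ℰp) i U)} ∩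
          {U : GaugeField (F.P K) 0 (Matrix.specialUnitaryGroup (Fin 2) ℂ) | ¬ PlaqSmall (θBal F.L γ b₀ p₀ (K - (j + 2))) (Averaging.iter (fun i' => BlockAveraging.blockAvg (P := F.P K) (j := i') ℰp) (j + 2) U)})
        ≤ (gibbsK F ℰp γ K).real ({U : GaugeField (F.P K) 0 (Matrix.specialUnitaryGroup (Fin 2) ℂ) | θBal F.L γ b₀ p₀ (K - j) ≤ GaugeGroup.dist1 (GaugeField.plaqHol (Averaging.iter (fun i' => BlockAveraging.blockAvg (P := F.P K) (j := i') ℰp) j U) a)} ∩ {U : GaugeField (F.P K) 0 (Matrix.specialUnitaryGroup (Fin 2) ℂ) | (∀ (i : ℕ) (q : Plaq (F.P K) i), i < j → Site.tdist (fun k => ((((q.src k).val * F.L ^ i : ℕ)) : ZMod ((F.P K).sitesPerDir 0))) (fun k => ((((a.src k).val * F.L ^ j : ℕ)) : ZMod ((F.P K).sitesPerDir 0))) + 64 * F.L ^ i ≤ 64 * F.L ^ j → GaugeGroup.dist1 (GaugeField.plaqHol (Averaging.iter (fun i' => BlockAveraging.blockAvg (P := F.P K) (j := i') ℰp) i U)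 q) < θBal F.L γ b₀ p₀ (K - i))}) :=
          measureReal_mono hsub (measure_ne_top _ _)
      _ ≤ C * Real.exp (-(c * B10.pFun b₀ p₀ (Real.sqrt (γ * ((F.L : ℝ)⁻¹) ^ (K - j))) ^ 2)) := H F γ hFL hγ hle K j hj hjK a
      _ = C * (F.scheme ℰp γ).β (K - j) ^ 0 * Real.exp (-(c * B10.pFun b₀ p₀ (Real.sqrt (γ * ((F.L : ℝ)⁻¹) ^ (K - j))) ^ 2)) := by
          rw [pow_zero, mul_one]

/-- ★ DISPLAY 2 — «`HistoryTailL` MODULO {K1, K2, QUANTILE}»: the crux of record `UnitScaleTilt.HistoryTailL` (stmt-QuantumFields-19936) BY NAME from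
K1, K2 and the stubs (Q), (T), through the landed `fibreConvexityTail_historyTailOfTwoSided_proof` (p609164).  No `MeanDeviationL`. -/
theorem HistoryTailL_of
    (hC : Summit.QuantumFields.YangMills.Theses.PoincareLipschitz.MesoscopicConcentrationL)
    (hLip : Summit.QuantumFields.YangMills.Theses.PoincareLipschitz.BlockLipschitzL) :
    Summit.QuantumFields.YangMills.Theses.UnitScaleTilt.HistoryTailL :=
  Summit.QuantumFields.YangMills.Theorems.fibreConvexityTail_historyTailOfTwoSided_proof
    (TwoSided_of stub_localTailOfMedian stub_quantileDeviation hC hLip).1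
    (TwoSided_of stub_localTailOfMedian stub_quantileDeviation hC hLip).2

end Summit.QuantumFields.YangMills.Cruxes.HistoryTailL.MedianCentring
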